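import Summits.AnomalousDissipation.AnomalousDissipation.Theorems.SolenoidalFractalHomogenisationLagrangianStepSidebandLadderBounds
import HarnessLib

/-!
# K1L_D `stub_D1_V0thg` (stmt-AnomalousDissipation-27980), R3′ lane «SidebandTailCrushing» (tenure D28-16 (3) / D28-20) — file F4c:
# LADDER SUMS — `‖hopL y‖² + ‖C y‖²` and the commutator pairing `⟪K y, [C, hopL] y⟫` as site sums over the amplitudes

Helper file of route `SolenoidalFractalHomogenisation` (prover seat `ad-k1l-cellLawV-w1` g10; plan memo
`Cruxes/LagrangianRenormalisationStepDesign/Lines/onelevel-vtheta-R3-plan.md` §3 (S)(U); `--supports stmt-AnomalousDissipation-27980 --as helper`).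
For a state `y` of the ladder subspace `ladderSub R (ladder z₀ mᵢ)` (transversal, supported on the `mᵢ`-ladder through `z₀`), with `H = hopL`, `K = indexL`,
`C y = K H y − H K y`, `a = 2π|êᵢ·z₀|‖αᵢ‖`:
* `sum_box_shift` — reindexing `Σ_{z ∈ box, z−m ∈ box} h(z) = Σ_{w ∈ box, w+m ∈ box} h(w+m)`;
* per site (parallelogram law and the cross pairing, `y∓ = y_{z∓m}`):  `‖(Hy)_z‖² + ‖(Cy)_z‖² = 2|c_z|²‖α‖²(‖P_z y₋‖² + ‖P_z y₊‖²)` and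
  `Re⟪(CKy)_z,(Hy)_z⟫ + Re⟪(HKy)_z,(Cy)_z⟫ = 2|c_z|²‖α‖²((κ(z)−1)‖P_z y₋‖² − (κ(z)+1)‖P_z y₊‖²)`;
* summed and reindexed (`|c_z| = 2π|êᵢ·z₀|` on the ladder, `κ(z∓m) = κ(z) ∓ 1`):
  **`norm_sq_hopL_add_norm_sq_bond`**: `‖Hy‖² + ‖Cy‖² = 2a² Σ_w ([w+m ∈ box]‖P_{w+m}y_w‖² + [w−m ∈ box]‖P_{w−m}y_w‖²)` (the `M² − J² = 2(S*S+SS*)` identity) and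
  **`inner_indexL_commutator`**: `⟪Ky, C(Hy) − H(Cy)⟫_ℝ = 2a² Σ_w κ(w)([w+m ∈ box]‖P_{w+m}y_w‖² − [w−m ∈ box]‖P_{w−m}y_w‖²)` (the `[C,B] = 2(S*S−SS*)`
  identity) — the inputs of (U) and (S) of file F2 at the level of `Space R`.
No definitions, no sorry.  NOT a proof of `stub_D1_V0thg`, of K1L_D or of AD; rung F-D1.A0 infrastructure.
-/

set_option linter.dupNamespace false -- single-conjunct summit: `Summit.AnomalousDissipation.AnomalousDissipation.…` is the mandated namespace

noncomputable section

namespace Summit.AnomalousDissipation.AnomalousDissipation.Theorems.SolenoidalFractalHomogenisation.LagrangianStep.Sideband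

open Set Complex
open scoped InnerProductSpace
open Literature.Analysis Literature.Analysis.FunctionSpaces Literature.Analysis.FunctionSpaces.Torus
open Literature.Analysis.FluidPDE Literature.Analysis.FluidPDE.Torus Literature.Analysis.FluidPDE.LatticeShear
open Summit.AnomalousDissipation.AnomalousDissipation.Theorems.SolenoidalFractalHomogenisation.LagrangianStep.CellChain
  (linkCoeff kdot_transversalProj' inner_transversalProj_left_of_kdot_eq_zero norm_transversalProj_le)

variable {k₀ : ℕ}

/-! ## §1 Reindexing along a shift -/

/-- **Reindexing along a shift**: `Σ_{z ∈ box} [z−m ∈ box]·h(z) = Σ_{w ∈ box} [w+m ∈ box]·h(w+m)`. [folklore] -/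
theorem sum_box_shift (R : ℕ) (m : Fin 3 → ℤ) (h : (Fin 3 → ℤ) → ℝ) :
    ∑ z : box R, (if z.1 - m ∈ box R then h z.1 else 0) = ∑ w : box R, (if w.1 + m ∈ box R then h (w.1 + m) else 0) := by
  classical
  rw [Finset.sum_coe_sort (box R) (fun z => if z - m ∈ box R then h z else 0),
    Finset.sum_coe_sort (box R) (fun w => if w + m ∈ box R then h (w + m) else 0),
    ← Finset.sum_filter, ← Finset.sum_filter]
  have himg : (box R).filter (fun z => z - m ∈ box R) = ((box R).filter (fun w => w + m ∈ box R)).image (fun w => w + m) := by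
    ext z
    simp only [Finset.mem_filter, Finset.mem_image]
    constructor
    · rintro ⟨hz, hzm⟩
      exact ⟨z - m, ⟨hzm, by rwa [sub_add_cancel]⟩, sub_add_cancel z m⟩
    · rintro ⟨w, ⟨hw, hwm⟩, rfl⟩
      exact ⟨hwm, by rwa [add_sub_cancel_right]⟩
  rw [himg, Finset.sum_image (fun a _ b _ hab => add_right_cancel hab)]


/-- **Reindexing along a shift** (other direction): `Σ_{z ∈ box} [z+m ∈ box]·h(z) = Σ_{w ∈ box} [w−m ∈ box]·h(w−m)`. [folklore] -/
theorem sum_box_shift_add (R : ℕ) (m : Fin 3 → ℤ) (h : (Fin 3 → ℤ) → ℝ) :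
    ∑ z : box R, (if z.1 + m ∈ box R then h z.1 else 0) = ∑ w : box R, (if w.1 - m ∈ box R then h (w.1 - m) else 0) := by
  have h1 := sum_box_shift R (-m) h
  have e1 : ∀ z : box R, (if z.1 + m ∈ box R then h z.1 else 0) = (if z.1 - -m ∈ box R then h z.1 else 0) := by
    intro z; rw [sub_neg_eq_add]
  have e2 : ∀ w : box R, (if w.1 - m ∈ box R then h (w.1 - m) else 0) = (if w.1 + -m ∈ box R then h (w.1 + -m) else 0) := by
    intro w; rw [← sub_eq_add_neg]
  rw [Finset.sum_congr rfl fun z _ => e1 z, Finset.sum_congr rfl fun w _ => e2 w, h1]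

/-! ## §2 Per-site forms on the ladder subspace -/

section PerSite

variable (W₁ : LatticeWord k₀) {R : ℕ} (i : Fin k₀) {L : Set (Fin 3 → ℤ)} {y : Space R}

/-- `(Hy)_z = c_z • (αᵢ • P_z y₋ + ᾱᵢ • P_z y₊)` on transversal states. [cite: MeshalkinSinai1961, pp. 1700–1705] -/
theorem hopL_apply_of_mem (hy : y ∈ ladderSub R L) (z : box R) :
    hopL W₁ R i y z = hopCoeff W₁ i z.1 • (slotAmp W₁ i • transversalProj z.1 (coordL R (z.1 - (W₁.phase i).m) y) +
      starRingEnd ℂ (slotAmp W₁ i) • transversalProj z.1 (coordL R (z.1 + (W₁.phase i).m) y)) := by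
  rw [hopL_apply, linkBlock_apply, transversalProj_eq_self_of_kdot_eq_zero _ (kdot_coordL_of_mem_ladderSub hy _),
    transversalProj_eq_self_of_kdot_eq_zero _ (kdot_coordL_of_mem_ladderSub hy _), map_add, map_smul, map_smul]

/-- `(Cy)_z = c_z • (αᵢ • P_z y₋ − ᾱᵢ • P_z y₊)` on transversal states (`m ≠ 0`). [cite: BedrossianCotiZelati2017, §2] -/
theorem bond_apply_of_mem (hm : zdot (W₁.phase i).m (W₁.phase i).m ≠ 0) (hy : y ∈ ladderSub R L) (z : box R) :
    (indexL R (W₁.phase i).m (hopL W₁ R i y) - hopL W₁ R i (indexL R (W₁.phase i).m y)) z =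
      hopCoeff W₁ i z.1 • (slotAmp W₁ i • transversalProj z.1 (coordL R (z.1 - (W₁.phase i).m) y) -
        starRingEnd ℂ (slotAmp W₁ i) • transversalProj z.1 (coordL R (z.1 + (W₁.phase i).m) y)) := by
  rw [indexL_hopL_sub_apply W₁ R i hm y z, transversalProj_eq_self_of_kdot_eq_zero _ (kdot_coordL_of_mem_ladderSub hy _),
    transversalProj_eq_self_of_kdot_eq_zero _ (kdot_coordL_of_mem_ladderSub hy _), map_sub, map_smul, map_smul]

/-- **Parallelogram per site**: `‖(Hy)_z‖² + ‖(Cy)_z‖² = 2‖c_z‖²‖αᵢ‖²(‖P_z y₋‖² + ‖P_z y₊‖²)`. [cite: BedrossianCotiZelati2017, §2] -/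
theorem norm_sq_hopL_add_norm_sq_bond_apply (hm : zdot (W₁.phase i).m (W₁.phase i).m ≠ 0) (hy : y ∈ ladderSub R L) (z : box R) :
    ‖hopL W₁ R i y z‖ ^ 2 + ‖(indexL R (W₁.phase i).m (hopL W₁ R i y) - hopL W₁ R i (indexL R (W₁.phase i).m y)) z‖ ^ 2 =
      2 * ‖hopCoeff W₁ i z.1‖ ^ 2 * ‖slotAmp W₁ i‖ ^ 2 *
        (‖transversalProj z.1 (coordL R (z.1 - (W₁.phase i).m) y)‖ ^ 2 + ‖transversalProj z.1 (coordL R (z.1 + (W₁.phase i).m) y)‖ ^ 2) := by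
  rw [hopL_apply_of_mem W₁ i hy z, bond_apply_of_mem W₁ i hm hy z, norm_smul, norm_smul, mul_pow, mul_pow, ← mul_add,
    parallelogram_law_with_norm ℂ, norm_smul, norm_smul, RCLike.norm_conj, mul_pow, mul_pow]
  ring

/-- **Cross pairing per site**: `Re⟪(CKy)_z,(Hy)_z⟫ + Re⟪(HKy)_z,(Cy)_z⟫ = 2‖c_z‖²‖αᵢ‖²((κ(z)−1)‖P_z y₋‖² − (κ(z)+1)‖P_z y₊‖²)`.
[cite: BedrossianCotiZelati2017, §2 (the commutator term)] -/
theorem re_inner_cross_apply (hm : zdot (W₁.phase i).m (W₁.phase i).m ≠ 0) (hy : y ∈ ladderSub R L) (z : box R) :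
    (⟪(indexL R (W₁.phase i).m (hopL W₁ R i (indexL R (W₁.phase i).m y)) -
          hopL W₁ R i (indexL R (W₁.phase i).m (indexL R (W₁.phase i).m y))) z, hopL W₁ R i y z⟫_ℂ).re +
      (⟪hopL W₁ R i (indexL R (W₁.phase i).m y) z,
          (indexL R (W₁.phase i).m (hopL W₁ R i y) - hopL W₁ R i (indexL R (W₁.phase i).m y)) z⟫_ℂ).re =
      2 * ‖hopCoeff W₁ i z.1‖ ^ 2 * ‖slotAmp W₁ i‖ ^ 2 *
        ((siteIndex (W₁.phase i).m z.1 - 1) * ‖transversalProj z.1 (coordL R (z.1 - (W₁.phase i).m) y)‖ ^ 2 -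
          (siteIndex (W₁.phase i).m z.1 + 1) * ‖transversalProj z.1 (coordL R (z.1 + (W₁.phase i).m) y)‖ ^ 2) := by
  have hKy : indexL R (W₁.phase i).m y ∈ ladderSub R L := indexL_mem_ladderSub _ hy
  rw [bond_apply_of_mem W₁ i hm hKy z, hopL_apply_of_mem W₁ i hKy z, hopL_apply_of_mem W₁ i hy z, bond_apply_of_mem W₁ i hm hy z,
    indexL, coordL_diagL, coordL_diagL, siteIndex_sub_self hm, siteIndex_add_self hm, map_smul, map_smul]
  -- abbreviate
  set c : ℂ := hopCoeff W₁ i z.1 with hc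
  set α : ℂ := slotAmp W₁ i with hα
  set κ : ℝ := siteIndex (W₁.phase i).m z.1 with hκ
  set u : EuclideanSpace ℂ (Fin 3) := transversalProj z.1 (coordL R (z.1 - (W₁.phase i).m) y) with hu
  set v : EuclideanSpace ℂ (Fin 3) := transversalProj z.1 (coordL R (z.1 + (W₁.phase i).m) y) with hv
  push_cast
  -- expand the two pairings
  have key : ∀ s t : ℝ,
      (⟪c • (α • ((s : ℂ) • u) - starRingEnd ℂ α • ((t : ℂ) • v)), c • (α • u + starRingEnd ℂ α • v)⟫_ℂ).re +
        (⟪c • (α • ((s : ℂ) • u) + starRingEnd ℂ α • ((t : ℂ) • v)), c • (α • u - starRingEnd ℂ α • v)⟫_ℂ).re =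
      2 * ‖c‖ ^ 2 * ‖α‖ ^ 2 * (s * ‖u‖ ^ 2 - t * ‖v‖ ^ 2) := by
    intro s t
    have e1 : ⟪c • (α • ((s : ℂ) • u) - starRingEnd ℂ α • ((t : ℂ) • v)), c • (α • u + starRingEnd ℂ α • v)⟫_ℂ +
        ⟪c • (α • ((s : ℂ) • u) + starRingEnd ℂ α • ((t : ℂ) • v)), c • (α • u - starRingEnd ℂ α • v)⟫_ℂ =
        2 * (starRingEnd ℂ c * c) * ((starRingEnd ℂ α * α) * (s * ⟪u, u⟫_ℂ) - (α * starRingEnd ℂ α) * (t * ⟪v, v⟫_ℂ)) := by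
      simp only [inner_smul_left, inner_smul_right, inner_add_left, inner_add_right, inner_sub_left, inner_sub_right,
        Complex.conj_ofReal, starRingEnd_self_apply]
      ring
    rw [← Complex.add_re, e1]
    have hu2 : ⟪u, u⟫_ℂ = ((‖u‖ ^ 2 : ℝ) : ℂ) := by rw [inner_self_eq_norm_sq_to_K]; norm_cast
    have hv2 : ⟪v, v⟫_ℂ = ((‖v‖ ^ 2 : ℝ) : ℂ) := by rw [inner_self_eq_norm_sq_to_K]; norm_cast
    rw [hu2, hv2, mul_comm α (starRingEnd ℂ α), Complex.conj_mul', Complex.conj_mul']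
    have : (2 * ((‖c‖ : ℂ) ^ 2) * (((‖α‖ : ℂ) ^ 2) * ((s : ℂ) * ((‖u‖ ^ 2 : ℝ) : ℂ)) - ((‖α‖ : ℂ) ^ 2) * ((t : ℂ) * ((‖v‖ ^ 2 : ℝ) : ℂ)))) =
        ((2 * ‖c‖ ^ 2 * ‖α‖ ^ 2 * (s * ‖u‖ ^ 2 - t * ‖v‖ ^ 2) : ℝ) : ℂ) := by
      push_cast; ring
    rw [this, Complex.ofReal_re]
  have h := key (κ - 1) (κ + 1)
  push_cast at h
  exact h

end PerSite

/-! ## §3 The global identities -/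

/-- `zdot mᵢ mᵢ ≠ 0`. [folklore] -/
theorem zdot_self_ne_zero (W₁ : LatticeWord k₀) (i : Fin k₀) : zdot (W₁.phase i).m (W₁.phase i).m ≠ 0 := by
  have h : (0 : ℝ) < freqNormSq (W₁.phase i).m := freqNormSq_pos_of_ne_zero' (W₁.phase i).m_ne
  have e : (zdot (W₁.phase i).m (W₁.phase i).m : ℝ) = freqNormSq (W₁.phase i).m := by
    rw [cast_zdot, freqNormSq]; exact Finset.sum_congr rfl fun j _ => by ring
  have : (zdot (W₁.phase i).m (W₁.phase i).m : ℝ) ≠ 0 := by rw [e]; exact h.ne'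
  exact_mod_cast this

/-- **`‖Hy‖² + ‖Cy‖²` as a sum over amplitudes** (`M² − J² = 2(S*S + SS*)`):
`‖Hy‖² + ‖Cy‖² = 2a²·Σ_w ([w+m ∈ box]‖P_{w+m}y_w‖² + [w−m ∈ box]‖P_{w−m}y_w‖²)`, `a = 2π|êᵢ·z₀|‖αᵢ‖`. [cite: BedrossianCotiZelati2017, §2] -/
theorem norm_sq_hopL_add_norm_sq_bond (W₁ : LatticeWord k₀) {R : ℕ} (i : Fin k₀) (z₀ : Fin 3 → ℤ) {y : Space R}
    (hy : y ∈ ladderSub R (ladder z₀ (W₁.phase i).m)) :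
    ‖hopL W₁ R i y‖ ^ 2 + ‖indexL R (W₁.phase i).m (hopL W₁ R i y) - hopL W₁ R i (indexL R (W₁.phase i).m y)‖ ^ 2 =
      2 * (2 * Real.pi * |∑ a, (W₁.phase i).e a * (z₀ a : ℝ)| * ‖slotAmp W₁ i‖) ^ 2 *
        ∑ w : box R, ((if w.1 + (W₁.phase i).m ∈ box R then ‖transversalProj (w.1 + (W₁.phase i).m) (y w)‖ ^ 2 else 0) +
          (if w.1 - (W₁.phase i).m ∈ box R then ‖transversalProj (w.1 - (W₁.phase i).m) (y w)‖ ^ 2 else 0)) := by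
  have hm := zdot_self_ne_zero W₁ i
  rw [PiLp.norm_sq_eq_of_L2, PiLp.norm_sq_eq_of_L2, ← Finset.sum_add_distrib]
  have hsite : ∀ z : box R, ‖hopL W₁ R i y z‖ ^ 2 + ‖(indexL R (W₁.phase i).m (hopL W₁ R i y) - hopL W₁ R i (indexL R (W₁.phase i).m y)) z‖ ^ 2 =
      2 * (2 * Real.pi * |∑ a, (W₁.phase i).e a * (z₀ a : ℝ)| * ‖slotAmp W₁ i‖) ^ 2 *
        ((if z.1 - (W₁.phase i).m ∈ box R then ‖transversalProj z.1 (coordL R (z.1 - (W₁.phase i).m) y)‖ ^ 2 else 0) +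
          (if z.1 + (W₁.phase i).m ∈ box R then ‖transversalProj z.1 (coordL R (z.1 + (W₁.phase i).m) y)‖ ^ 2 else 0)) := by
    intro z
    have e1 : (if z.1 - (W₁.phase i).m ∈ box R then ‖transversalProj z.1 (coordL R (z.1 - (W₁.phase i).m) y)‖ ^ 2 else 0) =
        ‖transversalProj z.1 (coordL R (z.1 - (W₁.phase i).m) y)‖ ^ 2 := by
      by_cases h : z.1 - (W₁.phase i).m ∈ box R
      · rw [if_pos h]
      · rw [if_neg h, coordL_apply_of_not_mem h, map_zero, norm_zero]; ring
    have e2 : (if z.1 + (W₁.phase i).m ∈ box R then ‖transversalProj z.1 (coordL R (z.1 + (W₁.phase i).m) y)‖ ^ 2 else 0) =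
        ‖transversalProj z.1 (coordL R (z.1 + (W₁.phase i).m) y)‖ ^ 2 := by
      by_cases h : z.1 + (W₁.phase i).m ∈ box R
      · rw [if_pos h]
      · rw [if_neg h, coordL_apply_of_not_mem h, map_zero, norm_zero]; ring
    rw [norm_sq_hopL_add_norm_sq_bond_apply W₁ i hm hy z, e1, e2]
    by_cases hz : z.1 ∈ ladder z₀ (W₁.phase i).m
    · rw [norm_hopCoeff, sum_e_mul_eq_of_mem_ladder W₁ i hz]; ring
    · have h1 : z.1 - (W₁.phase i).m ∉ ladder z₀ (W₁.phase i).m := fun h => hz (sub_mem_ladder_iff.1 h)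
      have h2 : z.1 + (W₁.phase i).m ∉ ladder z₀ (W₁.phase i).m := fun h => hz (add_mem_ladder_iff.1 h)
      rw [coordL_eq_zero_of_mem_ladderSub hy h1, coordL_eq_zero_of_mem_ladderSub hy h2, map_zero, norm_zero]; ring
  have hA : ∑ z : box R, (if z.1 - (W₁.phase i).m ∈ box R then ‖transversalProj z.1 (coordL R (z.1 - (W₁.phase i).m) y)‖ ^ 2 else 0) =
      ∑ w : box R, (if w.1 + (W₁.phase i).m ∈ box R then ‖transversalProj (w.1 + (W₁.phase i).m) (y w)‖ ^ 2 else 0) := by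
    have hs := sum_box_shift R (W₁.phase i).m (fun z => ‖transversalProj z (coordL R (z - (W₁.phase i).m) y)‖ ^ 2)
    rw [hs]
    refine Finset.sum_congr rfl fun w _ => ?_
    by_cases hw : w.1 + (W₁.phase i).m ∈ box R
    · rw [if_pos hw, if_pos hw, add_sub_cancel_right, coordL_coe_apply]
    · rw [if_neg hw, if_neg hw]
  have hB : ∑ z : box R, (if z.1 + (W₁.phase i).m ∈ box R then ‖transversalProj z.1 (coordL R (z.1 + (W₁.phase i).m) y)‖ ^ 2 else 0) =
      ∑ w : box R, (if w.1 - (W₁.phase i).m ∈ box R then ‖transversalProj (w.1 - (W₁.phase i).m) (y w)‖ ^ 2 else 0) := by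
    have hs := sum_box_shift_add R (W₁.phase i).m (fun z => ‖transversalProj z (coordL R (z + (W₁.phase i).m) y)‖ ^ 2)
    rw [hs]
    refine Finset.sum_congr rfl fun w _ => ?_
    by_cases hw : w.1 - (W₁.phase i).m ∈ box R
    · rw [if_pos hw, if_pos hw, sub_add_cancel, coordL_coe_apply]
    · rw [if_neg hw, if_neg hw]
  calc ∑ z : box R, (‖hopL W₁ R i y z‖ ^ 2 + ‖(indexL R (W₁.phase i).m (hopL W₁ R i y) - hopL W₁ R i (indexL R (W₁.phase i).m y)) z‖ ^ 2)
      = ∑ z : box R, 2 * (2 * Real.pi * |∑ a, (W₁.phase i).e a * (z₀ a : ℝ)| * ‖slotAmp W₁ i‖) ^ 2 *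
        ((if z.1 - (W₁.phase i).m ∈ box R then ‖transversalProj z.1 (coordL R (z.1 - (W₁.phase i).m) y)‖ ^ 2 else 0) +
          (if z.1 + (W₁.phase i).m ∈ box R then ‖transversalProj z.1 (coordL R (z.1 + (W₁.phase i).m) y)‖ ^ 2 else 0)) :=
        Finset.sum_congr rfl fun z _ => hsite z
    _ = 2 * (2 * Real.pi * |∑ a, (W₁.phase i).e a * (z₀ a : ℝ)| * ‖slotAmp W₁ i‖) ^ 2 *
        ((∑ z : box R, (if z.1 - (W₁.phase i).m ∈ box R then ‖transversalProj z.1 (coordL R (z.1 - (W₁.phase i).m) y)‖ ^ 2 else 0)) +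
          ∑ z : box R, (if z.1 + (W₁.phase i).m ∈ box R then ‖transversalProj z.1 (coordL R (z.1 + (W₁.phase i).m) y)‖ ^ 2 else 0)) := by
        rw [← Finset.mul_sum, Finset.sum_add_distrib]
    _ = _ := by rw [hA, hB, ← Finset.sum_add_distrib]

/-- **The commutator pairing as a signed sum over amplitudes** (`[C,B] = 2(S*S − SS*)`):
`⟪Ky, C(Hy) − H(Cy)⟫_ℝ = 2a²·Σ_w κ(w)([w+m ∈ box]‖P_{w+m}y_w‖² − [w−m ∈ box]‖P_{w−m}y_w‖²)` with `C = K H − H K`, `K = indexL`, `H = hopL`.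
[cite: BedrossianCotiZelati2017, §2 (the commutator term)] -/
theorem inner_indexL_commutator (W₁ : LatticeWord k₀) {R : ℕ} (i : Fin k₀) (z₀ : Fin 3 → ℤ) {y : Space R}
    (hy : y ∈ ladderSub R (ladder z₀ (W₁.phase i).m)) :
    ⟪indexL R (W₁.phase i).m y,
      (indexL R (W₁.phase i).m (hopL W₁ R i (hopL W₁ R i y)) - hopL W₁ R i (indexL R (W₁.phase i).m (hopL W₁ R i y))) -
        hopL W₁ R i (indexL R (W₁.phase i).m (hopL W₁ R i y) - hopL W₁ R i (indexL R (W₁.phase i).m y))⟫_ℝ =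
      2 * (2 * Real.pi * |∑ a, (W₁.phase i).e a * (z₀ a : ℝ)| * ‖slotAmp W₁ i‖) ^ 2 *
        ∑ w : box R, siteIndex (W₁.phase i).m w.1 *
          ((if w.1 + (W₁.phase i).m ∈ box R then ‖transversalProj (w.1 + (W₁.phase i).m) (y w)‖ ^ 2 else 0) -
            (if w.1 - (W₁.phase i).m ∈ box R then ‖transversalProj (w.1 - (W₁.phase i).m) (y w)‖ ^ 2 else 0)) := by
  have hm := zdot_self_ne_zero W₁ i
  have hKy : indexL R (W₁.phase i).m y ∈ ladderSub R (ladder z₀ (W₁.phase i).m) := indexL_mem_ladderSub _ hy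
  have hKs : ∀ u v : Space R, ⟪indexL R (W₁.phase i).m u, v⟫_ℝ = ⟪u, indexL R (W₁.phase i).m v⟫_ℝ :=
    fun u v => real_inner_diagL_comm R _ u v
  have hHs : ∀ u v : Space R, ⟪hopL W₁ R i u, v⟫_ℝ = -⟪u, hopL W₁ R i v⟫_ℝ := fun u v => real_inner_hopL_comm W₁ R i u v
  -- ⟪Ky, C(Hy)⟫ = ⟪C(Ky), Hy⟫ (C symmetric) and ⟪Ky, H(Cy)⟫ = −⟪H(Ky), Cy⟫ (H skew)
  have hCs : ∀ u v : Space R, ⟪u, indexL R (W₁.phase i).m (hopL W₁ R i v) - hopL W₁ R i (indexL R (W₁.phase i).m v)⟫_ℝ =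
      ⟪indexL R (W₁.phase i).m (hopL W₁ R i u) - hopL W₁ R i (indexL R (W₁.phase i).m u), v⟫_ℝ := by
    intro u v
    have a1 := hKs u (hopL W₁ R i v)
    have a2 := hHs (indexL R (W₁.phase i).m u) v
    have a3 := hHs u (indexL R (W₁.phase i).m v)
    have a4 := hKs (hopL W₁ R i u) v
    rw [inner_sub_right, inner_sub_left]
    linarith
  have hb := hHs (indexL R (W₁.phase i).m y) (indexL R (W₁.phase i).m (hopL W₁ R i y) - hopL W₁ R i (indexL R (W₁.phase i).m y))
  have hb' : ⟪indexL R (W₁.phase i).m y, hopL W₁ R i (indexL R (W₁.phase i).m (hopL W₁ R i y) - hopL W₁ R i (indexL R (W₁.phase i).m y))⟫_ℝ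
      = -⟪hopL W₁ R i (indexL R (W₁.phase i).m y), indexL R (W₁.phase i).m (hopL W₁ R i y) - hopL W₁ R i (indexL R (W₁.phase i).m y)⟫_ℝ := by
    linarith
  rw [inner_sub_right, hCs, hb', sub_neg_eq_add, real_inner_space_eq_sum, real_inner_space_eq_sum, ← Finset.sum_add_distrib]
  have hsite : ∀ z : box R,
      (⟪(indexL R (W₁.phase i).m (hopL W₁ R i (indexL R (W₁.phase i).m y)) -
          hopL W₁ R i (indexL R (W₁.phase i).m (indexL R (W₁.phase i).m y))) z, hopL W₁ R i y z⟫_ℂ).re +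
        (⟪hopL W₁ R i (indexL R (W₁.phase i).m y) z,
          (indexL R (W₁.phase i).m (hopL W₁ R i y) - hopL W₁ R i (indexL R (W₁.phase i).m y)) z⟫_ℂ).re =
      2 * (2 * Real.pi * |∑ a, (W₁.phase i).e a * (z₀ a : ℝ)| * ‖slotAmp W₁ i‖) ^ 2 *
        ((siteIndex (W₁.phase i).m z.1 - 1) * (if z.1 - (W₁.phase i).m ∈ box R then ‖transversalProj z.1 (coordL R (z.1 - (W₁.phase i).m) y)‖ ^ 2 else 0) -
          (siteIndex (W₁.phase i).m z.1 + 1) * (if z.1 + (W₁.phase i).m ∈ box R then ‖transversalProj z.1 (coordL R (z.1 + (W₁.phase i).m) y)‖ ^ 2 else 0)) := by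
    intro z
    have e1 : (if z.1 - (W₁.phase i).m ∈ box R then ‖transversalProj z.1 (coordL R (z.1 - (W₁.phase i).m) y)‖ ^ 2 else 0) =
        ‖transversalProj z.1 (coordL R (z.1 - (W₁.phase i).m) y)‖ ^ 2 := by
      by_cases h : z.1 - (W₁.phase i).m ∈ box R
      · rw [if_pos h]
      · rw [if_neg h, coordL_apply_of_not_mem h, map_zero, norm_zero]; ring
    have e2 : (if z.1 + (W₁.phase i).m ∈ box R then ‖transversalProj z.1 (coordL R (z.1 + (W₁.phase i).m) y)‖ ^ 2 else 0) =
        ‖transversalProj z.1 (coordL R (z.1 + (W₁.phase i).m) y)‖ ^ 2 := by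
      by_cases h : z.1 + (W₁.phase i).m ∈ box R
      · rw [if_pos h]
      · rw [if_neg h, coordL_apply_of_not_mem h, map_zero, norm_zero]; ring
    rw [re_inner_cross_apply W₁ i hm hy z, e1, e2]
    by_cases hz : z.1 ∈ ladder z₀ (W₁.phase i).m
    · rw [norm_hopCoeff, sum_e_mul_eq_of_mem_ladder W₁ i hz]; ring
    · have h1 : z.1 - (W₁.phase i).m ∉ ladder z₀ (W₁.phase i).m := fun h => hz (sub_mem_ladder_iff.1 h)
      have h2 : z.1 + (W₁.phase i).m ∉ ladder z₀ (W₁.phase i).m := fun h => hz (add_mem_ladder_iff.1 h)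
      rw [coordL_eq_zero_of_mem_ladderSub hy h1, coordL_eq_zero_of_mem_ladderSub hy h2, map_zero, norm_zero]; ring
  -- reindex both families: κ(z) − 1 = κ(z − m), κ(z) + 1 = κ(z + m)
  have hA : ∑ z : box R, (siteIndex (W₁.phase i).m z.1 - 1) *
        (if z.1 - (W₁.phase i).m ∈ box R then ‖transversalProj z.1 (coordL R (z.1 - (W₁.phase i).m) y)‖ ^ 2 else 0) =
      ∑ w : box R, siteIndex (W₁.phase i).m w.1 * (if w.1 + (W₁.phase i).m ∈ box R then ‖transversalProj (w.1 + (W₁.phase i).m) (y w)‖ ^ 2 else 0) := by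
    have hs := sum_box_shift R (W₁.phase i).m
      (fun z => siteIndex (W₁.phase i).m (z - (W₁.phase i).m) * ‖transversalProj z (coordL R (z - (W₁.phase i).m) y)‖ ^ 2)
    have lhs : ∀ z : box R, (siteIndex (W₁.phase i).m z.1 - 1) *
        (if z.1 - (W₁.phase i).m ∈ box R then ‖transversalProj z.1 (coordL R (z.1 - (W₁.phase i).m) y)‖ ^ 2 else 0) =
        (if z.1 - (W₁.phase i).m ∈ box R then
          siteIndex (W₁.phase i).m (z.1 - (W₁.phase i).m) * ‖transversalProj z.1 (coordL R (z.1 - (W₁.phase i).m) y)‖ ^ 2 else 0) := by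
      intro z
      rw [siteIndex_sub_self hm]
      by_cases h : z.1 - (W₁.phase i).m ∈ box R
      · rw [if_pos h, if_pos h]
      · rw [if_neg h, if_neg h, mul_zero]
    rw [Finset.sum_congr rfl fun z _ => lhs z, hs]
    refine Finset.sum_congr rfl fun w _ => ?_
    by_cases hw : w.1 + (W₁.phase i).m ∈ box R
    · rw [if_pos hw, if_pos hw, add_sub_cancel_right, coordL_coe_apply]
    · rw [if_neg hw, if_neg hw, mul_zero]
  have hB : ∑ z : box R, (siteIndex (W₁.phase i).m z.1 + 1) *
        (if z.1 + (W₁.phase i).m ∈ box R then ‖transversalProj z.1 (coordL R (z.1 + (W₁.phase i).m) y)‖ ^ 2 else 0) =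
      ∑ w : box R, siteIndex (W₁.phase i).m w.1 * (if w.1 - (W₁.phase i).m ∈ box R then ‖transversalProj (w.1 - (W₁.phase i).m) (y w)‖ ^ 2 else 0) := by
    have hs := sum_box_shift_add R (W₁.phase i).m
      (fun z => siteIndex (W₁.phase i).m (z + (W₁.phase i).m) * ‖transversalProj z (coordL R (z + (W₁.phase i).m) y)‖ ^ 2)
    have lhs : ∀ z : box R, (siteIndex (W₁.phase i).m z.1 + 1) *
        (if z.1 + (W₁.phase i).m ∈ box R then ‖transversalProj z.1 (coordL R (z.1 + (W₁.phase i).m) y)‖ ^ 2 else 0) =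
        (if z.1 + (W₁.phase i).m ∈ box R then
          siteIndex (W₁.phase i).m (z.1 + (W₁.phase i).m) * ‖transversalProj z.1 (coordL R (z.1 + (W₁.phase i).m) y)‖ ^ 2 else 0) := by
      intro z
      rw [siteIndex_add_self hm]
      by_cases h : z.1 + (W₁.phase i).m ∈ box R
      · rw [if_pos h, if_pos h]
      · rw [if_neg h, if_neg h, mul_zero]
    rw [Finset.sum_congr rfl fun z _ => lhs z, hs]
    refine Finset.sum_congr rfl fun w _ => ?_
    by_cases hw : w.1 - (W₁.phase i).m ∈ box R
    · rw [if_pos hw, if_pos hw, sub_add_cancel, coordL_coe_apply]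
    · rw [if_neg hw, if_neg hw, mul_zero]
  calc ∑ z : box R, ((⟪(indexL R (W₁.phase i).m (hopL W₁ R i (indexL R (W₁.phase i).m y)) -
          hopL W₁ R i (indexL R (W₁.phase i).m (indexL R (W₁.phase i).m y))) z, hopL W₁ R i y z⟫_ℂ).re +
        (⟪hopL W₁ R i (indexL R (W₁.phase i).m y) z,
          (indexL R (W₁.phase i).m (hopL W₁ R i y) - hopL W₁ R i (indexL R (W₁.phase i).m y)) z⟫_ℂ).re)
      = ∑ z : box R, 2 * (2 * Real.pi * |∑ a, (W₁.phase i).e a * (z₀ a : ℝ)| * ‖slotAmp W₁ i‖) ^ 2 *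
        ((siteIndex (W₁.phase i).m z.1 - 1) * (if z.1 - (W₁.phase i).m ∈ box R then ‖transversalProj z.1 (coordL R (z.1 - (W₁.phase i).m) y)‖ ^ 2 else 0) -
          (siteIndex (W₁.phase i).m z.1 + 1) * (if z.1 + (W₁.phase i).m ∈ box R then ‖transversalProj z.1 (coordL R (z.1 + (W₁.phase i).m) y)‖ ^ 2 else 0)) :=
        Finset.sum_congr rfl fun z _ => hsite z
    _ = 2 * (2 * Real.pi * |∑ a, (W₁.phase i).e a * (z₀ a : ℝ)| * ‖slotAmp W₁ i‖) ^ 2 *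
        ((∑ z : box R, (siteIndex (W₁.phase i).m z.1 - 1) *
            (if z.1 - (W₁.phase i).m ∈ box R then ‖transversalProj z.1 (coordL R (z.1 - (W₁.phase i).m) y)‖ ^ 2 else 0)) -
          ∑ z : box R, (siteIndex (W₁.phase i).m z.1 + 1) *
            (if z.1 + (W₁.phase i).m ∈ box R then ‖transversalProj z.1 (coordL R (z.1 + (W₁.phase i).m) y)‖ ^ 2 else 0)) := by
        rw [← Finset.mul_sum, Finset.sum_sub_distrib]
    _ = _ := by
        rw [hA, hB, ← Finset.sum_sub_distrib]
        congr 1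
        exact Finset.sum_congr rfl fun w _ => by ring

end Summit.AnomalousDissipation.AnomalousDissipation.Theorems.SolenoidalFractalHomogenisation.LagrangianStep.Sideband

end
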